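import Mathlib
import Summits.Ventures.HodgeRepro.Tier4.Target
import Summits.Ventures.HodgeRepro.Tier4.Line3.Defs
import Summits.Ventures.HodgeRepro.Tier4.Line3.LocSScalarObstruction
import Summits.Ventures.HodgeRepro.Tier4.Line3.UnitCopySphere

/-!
# Tier4/Line3/SlotGeometricSum — the constants `κ_j(β)` of the per-slot scalar symmetry of the natural data, as a formula

Blind re-derivation cell `pub-hodge-repro`, Tier 4 «PROVE THE STEP», LINE L3, seat t4-L3-p2 (g2); plan-3 g3 S13566 (ii).  For the
natural slot function at a good split place `w` (slot-character value `u w j = μ_{j,w}(ϖ_w)`, lattice indicator) the local factor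
at `β • x`, `x` on the sphere of the centre (Gram entry a `w`-unit, so both halves of `x` are primitive), is the GEOMETRIC SUM
`Σ_{k = −v_w(β)}^{v_w̄(β)} (u w j)^k` (`v_w̄(β) = v_w(c β)`), while at `x` itself it is `1`.  This module writes that constant down in
the tree's vocabulary — `geomSum`, `valNat` (the `w`-adic order of an integer), `kappaAt`, `kappa` (product over a finite set `T` of
representatives of the good split conjugate pairs) — and the DISPLAYED clause `NaturalSlotSymmetric D xm u T bad` saying that the
slot functions are sphere-symmetric with these constants for every integer scalar `β ≠ 0` that is a unit at the bad places.  The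
clause is a statement about the print's data (the local computation of CENSUS-v0.29 §1 on the sphere), never a theorem; what IS
proved: `kappa_of_isUnit` (`κ = 1` for a unit `β`: the archimedean phase is all that remains, S13495) and the size bound
`norm_kappa_le` (`|κ_j(β)| ≤ ∏_{w ∈ T} (v_w(β) + v_w̄(β) + 1)` when the slot-character values have modulus `1` — x2 S13519 (1)).

Nothing here says anything about the status of the Hodge conjecture for CM abelian varieties, which is NOT proved
(HC_CM is NOT proved by anyone in this repository).
-/

set_option autoImplicit false

noncomputable section

namespace Summit.Ventures.HodgeRepro.Tier4.Line3

open Summit.Ventures.HodgeRepro.Tier4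
open Matrix NumberField
open scoped ComplexConjugate

/-- The geometric sum `Σ_{k = −a}^{b} u^k`. -/
def geomSum (u : ℂ) (a b : ℕ) : ℂ := ∑ k ∈ Finset.Icc (-(a : ℤ)) (b : ℤ), u ^ k

/-- `geomSum u 0 0 = 1`. -/
theorem geomSum_zero_zero (u : ℂ) : geomSum u 0 0 = 1 := by
  simp [geomSum]

/-- `|Σ_{k = −a}^{b} u^k| ≤ a + b + 1` when `|u| = 1`. -/
theorem norm_geomSum_le {u : ℂ} (hu : ‖u‖ = 1) (a b : ℕ) : ‖geomSum u a b‖ ≤ a + b + 1 := by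
  unfold geomSum
  refine (norm_sum_le _ _).trans ?_
  have h1 : ∀ k ∈ Finset.Icc (-(a : ℤ)) (b : ℤ), ‖u ^ k‖ = 1 := fun k _ => by rw [norm_zpow, hu, _root_.one_zpow]
  rw [Finset.sum_congr rfl h1, Finset.sum_const, Int.card_Icc, nsmul_eq_mul, mul_one]
  have : ((b : ℤ) + 1 - -(a : ℤ)).toNat = a + b + 1 := by omega
  rw [this]
  push_cast
  exact le_refl _

namespace T4Data

variable (X : T4Data)

/-- The `w`-adic order of an integer `β` of `E′` (the exponent of `w` in `(β)`; `0` at `β = 0` by convention). -/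
def valNat (w : IsDedekindDomain.HeightOneSpectrum (RingOfIntegers X.E)) (β : RingOfIntegers X.E) : ℕ :=
  (Associates.mk w.asIdeal).count (Associates.mk (Ideal.span {β})).factors

/-- A unit has order `0` at every prime. -/
theorem valNat_of_isUnit (w : IsDedekindDomain.HeightOneSpectrum (RingOfIntegers X.E)) {β : RingOfIntegers X.E}
    (hβ : IsUnit β) : X.valNat w β = 0 := by
  unfold valNat
  rw [Ideal.span_singleton_eq_top.2 hβ, ← Ideal.one_eq_top, Associates.mk_one, Associates.factors_one,
    Associates.count_zero w.associates_irreducible]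

/-- The local constant at the good split place `w`: the geometric sum of the slot-character value over the exponent range
`[−v_w(β), v_w̄(β)]` (`v_w̄(β) = v_w(c β)`). -/
def kappaAt (u : IsDedekindDomain.HeightOneSpectrum (RingOfIntegers X.E) → Fin 4 → ℂ)
    (w : IsDedekindDomain.HeightOneSpectrum (RingOfIntegers X.E)) (j : Fin 4) (β : RingOfIntegers X.E) : ℂ :=
  geomSum (u w j) (X.valNat w β) (X.valNat w (X.conjO β))

/-- **THE CONSTANT `κ_j(β)`** of the natural data: the product of the local geometric sums over a finite set `T` of
representatives of the good split conjugate pairs. -/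
def kappa (u : IsDedekindDomain.HeightOneSpectrum (RingOfIntegers X.E) → Fin 4 → ℂ)
    (T : Finset (IsDedekindDomain.HeightOneSpectrum (RingOfIntegers X.E))) (j : Fin 4) (β : RingOfIntegers X.E) : ℂ :=
  ∏ w ∈ T, X.kappaAt u w j β

/-- For a unit `β` every local constant is `1`: `κ_j(β) = 1`. -/
theorem kappa_of_isUnit (u : IsDedekindDomain.HeightOneSpectrum (RingOfIntegers X.E) → Fin 4 → ℂ)
    (T : Finset (IsDedekindDomain.HeightOneSpectrum (RingOfIntegers X.E))) (j : Fin 4) {β : RingOfIntegers X.E}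
    (hβ : IsUnit β) : X.kappa u T j β = 1 := by
  unfold kappa kappaAt
  refine Finset.prod_eq_one fun w _ => ?_
  rw [X.valNat_of_isUnit w hβ, X.valNat_of_isUnit w (hβ.map X.conjO), geomSum_zero_zero]

/-- **THE SIZE OF `κ_j(β)`**: `|κ_j(β)| ≤ ∏_{w ∈ T} (v_w(β) + v_w̄(β) + 1)` when the slot-character values have modulus `1`. -/
theorem norm_kappa_le (u : IsDedekindDomain.HeightOneSpectrum (RingOfIntegers X.E) → Fin 4 → ℂ)
    (hu : ∀ w j, ‖u w j‖ = 1) (T : Finset (IsDedekindDomain.HeightOneSpectrum (RingOfIntegers X.E))) (j : Fin 4)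
    (β : RingOfIntegers X.E) :
    ‖X.kappa u T j β‖ ≤ ∏ w ∈ T, ((X.valNat w β : ℝ) + X.valNat w (X.conjO β) + 1) := by
  unfold kappa
  rw [norm_prod]
  exact Finset.prod_le_prod (fun w _ => norm_nonneg _) fun w _ => norm_geomSum_le (hu w j) _ _

/-- **THE DISPLAYED CLAUSE OF THE NATURAL DATA**: for every non-zero integer scalar `β` that is a unit at the bad places, each slot
function is sphere-symmetric with the constant `κ_j(β)` (a statement about the print's local computation; not derived here). -/
def NaturalSlotSymmetric (D : X.ThetaData) (xm : X.Tuple)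
    (u : IsDedekindDomain.HeightOneSpectrum (RingOfIntegers X.E) → Fin 4 → ℂ)
    (T bad : Finset (IsDedekindDomain.HeightOneSpectrum (RingOfIntegers X.E))) : Prop :=
  ∀ β : RingOfIntegers X.E, β ≠ 0 → (∀ w ∈ bad, X.valNat w β = 0) →
    ∀ j, X.SphereScalarSymmetric D xm j (algebraMap _ X.E β) (X.kappa u T j β)

/-- Under the displayed clause, a unit scalar carries the constant `1` at every slot. -/
theorem sphereScalarSymmetric_one_of_natural (D : X.ThetaData) (xm : X.Tuple)
    (u : IsDedekindDomain.HeightOneSpectrum (RingOfIntegers X.E) → Fin 4 → ℂ)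
    (T bad : Finset (IsDedekindDomain.HeightOneSpectrum (RingOfIntegers X.E))) (h : X.NaturalSlotSymmetric D xm u T bad)
    {β : RingOfIntegers X.E} (hβ : IsUnit β) (j : Fin 4) :
    X.SphereScalarSymmetric D xm j (algebraMap _ X.E β) 1 := by
  have := h β hβ.ne_zero (fun w _ => X.valNat_of_isUnit w hβ) j
  rwa [X.kappa_of_isUnit u T j hβ] at this

end T4Data

end Summit.Ventures.HodgeRepro.Tier4.Line3

end
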